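import Summits.QuantumFields.YangMills.Theorems.BalabanUVNodesPortTok182WholeTorus
import Literature.MathematicalPhysics.QuantumFieldTheory.Balaban1983to89.B6SectAWholeTorusBridge
import Literature.MathematicalPhysics.QuantumFieldTheory.Balaban1983to89.B6BlockDecayHjCovV1

/-!
# PORT PT-B (U8), g4 file 7 — NODE v8 LEAF (D1), FIRST FACE: THE WHOLE-TORUS WINDOW RESPONSE IS BAŁABAN's `H_{k+1}` OF [B5] (1.63), AND ITS KERNEL DECAYS —
# `windowResp … Finset.univ l b = Re H_{k+1}((x_b, μ_b), (l₂, l₁))` (✓`windowDomains_univ_eq_whole` → ✓`tVE_hOp_whole`) and ★★★ `norm_windowResp_univ_le`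
# (✓`B5Hk163Torus.norm_HkOp_le`): the VALUE clause of (‴-LocUniv) DISCHARGED from tree theorems, volume-uniform letters

Cell `ym-nodeO-ideate` ∕ `ym-balaban-port`, porter `ymgap-nodeO-port-PTB-1` (gen 4).  JOIN-side helper for **stmt-QuantumFields-27238** (K0ᴬ), `--supports … --as helper`.
NODE v8 (◇ lens-1 g7) leaf (D1): the displayed token (‴-LocUniv) of this porter's ✓`response9D_LocUniv_of_tokens` ∕ ✓`rowR4D_LocUniv_sandwich` is «IN-TREE modulo one
identification face»; this file IS that face for the value clause: the scalar whole-torus window response of DEF-1's ed.16 (`windowResp … Finset.univ`, [B6] (2.35) on the window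
family at `W = univ`) is carried by r03's ✓`B6SectAWholeTorusBridge` («(2.35) at the whole torus IS [B5] (1.63) `H_k`») and b05's ✓`B5Hk163Torus` (the typed `H_k` with its
torus-kernel decay `norm_HkOp_le`) to the letter-exact bound `|windowResp univ l b| ≤ MG163(d)·periodConst(κ₁₆₃(d), d−1)·e^{−(κ₁₆₃(d)∕d)·|y(b₋) − l₂|_{T,∞}}`, `d = 4`,
uniform in the volume `K`, the level `k` and the label.  [B5] = [Balaban1984PropagatorsI], [B6] = [Balaban1984PropagatorsII], [I] = [Balaban1987RG1].

WHAT IS PROVED (kernel, sorry-free).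
§1 `toLp_windowResp_eq_hOp` (unfolding on the standing range), `QE_windowResp_univ` (admissibility: `Q(H e_l) = e_l`), `hOp_QE_windowResp_univ` (`H(Q(H e_l)) = H e_l`).
§2 `tVE_hOp_QE_of_eq_whole` (transport of ✓`tVE_hOp_whole` along a family EQUAL to the whole family), ★★ `tVE_windowResp_univ`
   (`tVE (toLp (windowResp univ l)) = hkT L Mk (k+1) (tB 𝟙_{⟨l₂,l₁⟩})` — the window response IS (1.63)'s `H_{k+1}` on the indicator datum, ✓`bondAvgIter_windowResp_univ`).
§3 ★★ `windowResp_univ_eq_re_HkOp` (the value at a fine bond `b` is the real part of ONE kernel entry `H_{k+1}((EK b₋, μ_b), (l₂, l₁))`), ★★★ `norm_windowResp_univ_le`.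

HONEST FRAMING.  A DISCHARGE of the VALUE clause's identification face from TREE theorems (the lit-balaban∕pub-balaban typed skeleton of [B5]∕[B6], proofs landed there);
the first-difference clause (✓`B5Hk163TorusHolderDecay.norm_dker_bpt_le`) and the Laplacian∕curl clauses (critical-point equation (2.21)) are the next faces; the distance
dictionary `|·|_{T,∞}` vs `Site.tdist` (ℓ¹, `tdist ≤ d·|·|_{T,∞}`) is left to the consumer's constants.  Nothing of [I]∕[15] at the record is asserted; K0ᴬ 27238 OPEN;
NODE O 0∕1; COUNT 8∕28 · K 1∕4 UNMOVED; finite `𝕋⁴_{L^K}` at fixed ε — NOT continuum ∕ OS ∕ Clay; **the Yang–Mills mass gap (Clay) is NOT proved by any of this.**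
-/

noncomputable section

open scoped BigOperators

namespace Summit.QuantumFields.YangMills.Theorems.PortU8

open Literature.MathematicalPhysics.QuantumFieldTheory.Balaban1983to89
open Literature.MathematicalPhysics.QuantumFieldTheory.Balaban1983to89.T4Continuum (T4Family)
open Literature.MathematicalPhysics.QuantumFieldTheory.Balaban1983to89.LatticeFieldCalculus (bondAvgIter)
open Literature.MathematicalPhysics.QuantumFieldTheory.Balaban1983to89.B6SectADomainsV1 (Domains)
open Literature.MathematicalPhysics.QuantumFieldTheory.Balaban1983to89.B6SectAOperatorsV1 (QE QsE BondIdx BondIdxSpace)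
open Literature.MathematicalPhysics.QuantumFieldTheory.Balaban1983to89.B6SectAVectorModelV1 (GE EE)
open Literature.MathematicalPhysics.QuantumFieldTheory.Balaban1983to89.B6SectACriticalPointV1 (isCritical_hOp_V1)
open Literature.MathematicalPhysics.QuantumFieldTheory.Balaban1983to89.B6SectAWholeTorusBridge (tVE_hOp_whole)
open Literature.MathematicalPhysics.QuantumFieldTheory.BalabanImbrieJaffe1984to88.BIJ85AxialPropagator411 (BondSpace)
open Literature.MathematicalPhysics.QuantumFieldTheory.Balaban1983to89.B5Eq117TorusCarriers (Mk tB EK eBondK tB_apply)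
open Literature.MathematicalPhysics.QuantumFieldTheory.Balaban1983to89.B5Eq147TorusBridge (tVE tVE_apply)
open Literature.MathematicalPhysics.QuantumFieldTheory.Balaban1983to89.B5HkOpLandauMin (hkT hkT_def)
open Literature.MathematicalPhysics.QuantumFieldTheory.Balaban1983to89.B5TowerOneStroke (pullR pullR_apply towerE)
open Literature.MathematicalPhysics.QuantumFieldTheory.Balaban1983to89.B5Hk163Torus (HkOp HkOp_mulVec norm_HkOp_le)
open Literature.MathematicalPhysics.QuantumFieldTheory.Balaban1983to89.B5Prop11Plancherel (Tor fine)
open Literature.MathematicalPhysics.QuantumFieldTheory.Balaban1983to89.B5Eq118OneStroke (iterBlockOf)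
open Summit.QuantumFields.YangMills.Theorems.K0RecordFormatNames
open Summit.QuantumFields.YangMills.Theorems.PortTok182 (windowDomains_univ_eq_whole bondAvgIter_windowResp_univ)

variable (F : T4Family) {k K : ℕ}

/-! ## §1  The whole-torus window response as the (2.35) critical configuration on its own datum -/

/-- On the standing range the window response IS `H e_l` read bondwise: `toLp (windowResp W l) = hOp … (windowSrc W l)`. [cite: Balaban1984PropagatorsII, (2.35) p.228] -/
theorem toLp_windowResp_eq_hOp (hk : k + 1 ≤ (F.P K).m + (F.P K).K) (W : Finset (Site (F.P K) (k + 1))) (l : RespLabel F k K) :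
    WithLp.toLp 2 (windowResp F k K W l) =
      B6SectA.hOp (GE (windowDomains F k K hk W) (one_ne_zero (α := ℝ)) (w := fun _ => (1 : ℝ)) fun _ => one_pos)
        (QsE (windowDomains F k K hk W)) (EE (windowDomains F k K hk W) (one_ne_zero (α := ℝ)) (w := fun _ => (1 : ℝ)) fun _ => one_pos)
        (windowSrc F k K hk W l) := by
  ext b
  simp only [windowResp, dif_pos hk]

/-- Admissibility of the critical configuration: `Q (H e_l) = e_l` on the window family's data space. [cite: Balaban1984PropagatorsII, (2.6) p.224, (2.35) p.228] -/
theorem QE_windowResp (hk : k + 1 ≤ (F.P K).m + (F.P K).K) (W : Finset (Site (F.P K) (k + 1))) (l : RespLabel F k K) :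
    QE (windowDomains F k K hk W) (WithLp.toLp 2 (windowResp F k K W l)) = windowSrc F k K hk W l := by
  rw [toLp_windowResp_eq_hOp F hk W l]
  exact (isCritical_hOp_V1 (windowDomains F k K hk W) (one_ne_zero (α := ℝ)) (w := fun _ => (1 : ℝ)) (fun _ => one_pos) (windowSrc F k K hk W l)).1.1

/-- `H (Q (H e_l)) = H e_l`: the window response is the critical configuration on its OWN multi-scale datum. [cite: Balaban1984PropagatorsII, (2.35) p.228] -/
theorem hOp_QE_windowResp (hk : k + 1 ≤ (F.P K).m + (F.P K).K) (W : Finset (Site (F.P K) (k + 1))) (l : RespLabel F k K) :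
    B6SectA.hOp (GE (windowDomains F k K hk W) (one_ne_zero (α := ℝ)) (w := fun _ => (1 : ℝ)) fun _ => one_pos)
        (QsE (windowDomains F k K hk W)) (EE (windowDomains F k K hk W) (one_ne_zero (α := ℝ)) (w := fun _ => (1 : ℝ)) fun _ => one_pos)
        (QE (windowDomains F k K hk W) (WithLp.toLp 2 (windowResp F k K W l))) = WithLp.toLp 2 (windowResp F k K W l) := by
  rw [QE_windowResp F hk W l, toLp_windowResp_eq_hOp F hk W l]

/-! ## §2  Transport to the whole-torus family and to the tower: the window response IS (1.63)'s `H_{k+1}` on the indicator datum -/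

/-- ✓`tVE_hOp_whole` transported along a domain family EQUAL to the whole family (unit weights, `c = 1`). [cite: Balaban1984PropagatorsII, p.223 + (2.35) p.228; Balaban1984PropagatorsI, (1.63) p.28] -/
theorem tVE_hOp_QE_of_eq_whole {P : Params} {j : ℕ} (hj : j ≤ P.m + P.K) {D : Domains P} (hD : D = Domains.whole (P := P) j hj)
    (x₀ : BondSpace P) :
    tVE P hj (B6SectA.hOp (GE D (one_ne_zero (α := ℝ)) (w := fun _ => (1 : ℝ)) fun _ => one_pos) (QsE D)
        (EE D (one_ne_zero (α := ℝ)) (w := fun _ => (1 : ℝ)) fun _ => one_pos) (QE D x₀)) =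
      hkT P.L (Mk P j) j (tB (bondAvgIter j (WithLp.ofLp x₀))) := by
  subst hD
  exact tVE_hOp_whole hj (one_ne_zero (α := ℝ)) (s := (1 : ℝ)) one_ne_zero (fun _ => one_pos) x₀

/-- ★★ **THE WHOLE-TORUS WINDOW RESPONSE IS `H_{k+1}` OF (1.63) ON THE INDICATOR DATUM**: carried to the tower,
`tVE (toLp (windowResp univ l)) = hkT L Mk (k+1) (tB 𝟙_{⟨l₂, l₁⟩})`. [cite: Balaban1984PropagatorsI, (1.63) p.28, p.29 «Q_kH_kB = B»; Balaban1984PropagatorsII, (2.35) p.228, p.223] -/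
theorem tVE_windowResp_univ (hk : k + 1 ≤ (F.P K).m + (F.P K).K) (l : RespLabel F k K) :
    tVE (F.P K) hk (WithLp.toLp 2 (windowResp F k K Finset.univ l)) =
      hkT (F.P K).L (Mk (F.P K) (k + 1)) (k + 1) (tB fun c : PBond (F.P K) (k + 1) => if c = ⟨l.2, l.1⟩ then (1 : ℝ) else 0) := by
  classical
  have h := tVE_hOp_QE_of_eq_whole (P := F.P K) hk (windowDomains_univ_eq_whole F hk) (WithLp.toLp 2 (windowResp F k K Finset.univ l))
  rw [hOp_QE_windowResp F hk Finset.univ l, WithLp.ofLp_toLp] at h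
  rw [h]
  congr 2
  funext c
  exact bondAvgIter_windowResp_univ F hk l c

/-! ## §3  The value at a fine bond is ONE kernel entry of `H_{k+1}`; the (‴-LocUniv) value clause's decay -/

/-- ★★ **POINTWISE**: `windowResp univ l b = Re H_{k+1}((EK b₋, μ_b), (l₂, l₁))` — the real part of one entry of the typed (1.63) kernel.
[cite: Balaban1984PropagatorsI, (1.63) p.28; Balaban1984PropagatorsII, (2.35) p.228] -/
theorem windowResp_univ_eq_re_HkOp (hk : k + 1 ≤ (F.P K).m + (F.P K).K) (l : RespLabel F k K) (b : PBond (F.P K) 0) :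
    windowResp F k K Finset.univ l b =
      (HkOp ((F.P K).L ^ (k + 1)) (Mk (F.P K) (k + 1)) (EK hk b.src, b.dir) (l.2, l.1)).re := by
  classical
  have h1 : windowResp F k K Finset.univ l b = tVE (F.P K) hk (WithLp.toLp 2 (windowResp F k K Finset.univ l)) (eBondK hk b) := by
    rw [tVE_apply, Equiv.symm_apply_apply]
  rw [h1, tVE_windowResp_univ F hk l, hkT_def, pullR_apply, HkOp_mulVec]
  congr 1
  -- the indicator datum read on the torus carrier (one opaque point `p₀ = (l₂, l₁)` to keep `Site`∕`Tor` bookkeeping definitional)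
  obtain ⟨p₀, hp₀⟩ : ∃ p₀ : Tor (Mk (F.P K) (k + 1)) × Fin (F.P K).d, p₀ = (l.2, l.1) := ⟨_, rfl⟩
  have hδ : ∀ p : Tor (Mk (F.P K) (k + 1)) × Fin (F.P K).d,
      B5SectBStatements.cplx (tB fun c : PBond (F.P K) (k + 1) => if c = ⟨l.2, l.1⟩ then (1 : ℝ) else 0) p = if p = p₀ then 1 else 0 := by
    rintro ⟨y, lam⟩
    simp only [B5SectBStatements.cplx, tB_apply]
    by_cases h : (⟨y, lam⟩ : PBond (F.P K) (k + 1)) = ⟨l.2, l.1⟩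
    · have h' : ((y, lam) : Tor (Mk (F.P K) (k + 1)) × Fin (F.P K).d) = p₀ := by
        rw [hp₀]; obtain ⟨hy, hl⟩ := PBond.mk.inj h; exact Prod.ext hy hl
      rw [if_pos h, if_pos h']; simp
    · have h' : ((y, lam) : Tor (Mk (F.P K) (k + 1)) × Fin (F.P K).d) ≠ p₀ := by
        rw [hp₀]; intro h''; obtain ⟨hy, hl⟩ := Prod.mk.inj h''; exact h (by rw [hy, hl])
      rw [if_neg h, if_neg h']; simp
  set x : Tor (fine ((F.P K).L ^ (k + 1)) (Mk (F.P K) (k + 1))) := towerE (F.P K).L (Mk (F.P K) (k + 1)) (k + 1) ((eBondK hk) b).1 with hx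
  set μ : Fin (F.P K).d := ((eBondK hk) b).2 with hμ
  have hsum : (∑ y : Tor (Mk (F.P K) (k + 1)), ∑ lam : Fin (F.P K).d,
      B5Hk163Torus.hker ((F.P K).L ^ (k + 1)) (Mk (F.P K) (k + 1)) μ lam x y *
        B5SectBStatements.cplx (tB fun c : PBond (F.P K) (k + 1) => if c = ⟨l.2, l.1⟩ then (1 : ℝ) else 0) (y, lam)) =
      B5Hk163Torus.hker ((F.P K).L ^ (k + 1)) (Mk (F.P K) (k + 1)) μ p₀.2 x p₀.1 := by
    rw [← Fintype.sum_prod_type' (fun (y : Tor (Mk (F.P K) (k + 1))) (lam : Fin (F.P K).d) =>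
      B5Hk163Torus.hker ((F.P K).L ^ (k + 1)) (Mk (F.P K) (k + 1)) μ lam x y *
        B5SectBStatements.cplx (tB fun c : PBond (F.P K) (k + 1) => if c = ⟨l.2, l.1⟩ then (1 : ℝ) else 0) (y, lam))]
    have hre : ∀ p : Tor (Mk (F.P K) (k + 1)) × Fin (F.P K).d,
        B5Hk163Torus.hker ((F.P K).L ^ (k + 1)) (Mk (F.P K) (k + 1)) μ p.2 x p.1 *
          B5SectBStatements.cplx (tB fun c : PBond (F.P K) (k + 1) => if c = ⟨l.2, l.1⟩ then (1 : ℝ) else 0) (p.1, p.2) =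
        if p = p₀ then B5Hk163Torus.hker ((F.P K).L ^ (k + 1)) (Mk (F.P K) (k + 1)) μ p.2 x p.1 else 0 := by
      intro p; rw [hδ]; split_ifs <;> simp
    simp only [hre]
    rw [Finset.sum_ite_eq', if_pos (Finset.mem_univ _)]
  rw [hsum, hp₀]
  rfl

/-- ★★★ **THE VALUE CLAUSE OF (‴-LocUniv), DISCHARGED**: for every volume `K`, level `k` on the standing range, label `l` and fine bond `b`,
`|windowResp univ l b| ≤ MG163(d)·periodConst(κ₁₆₃(d), d−1) · e^{−(κ₁₆₃(d)∕d)·|y(b₋) − l₂|_{T,∞}}` (`d = (F.P K).d`, `y(b₋)` = the `(k+1)`-block of `b₋`, `|·|_{T,∞}` the periodic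
sup-distance of the unit torus `T^{(k+1)}`; the rate's denominator is printed `((d − 1 : ℕ) : ℝ) + 1 = d` to match the library's `Fin (d′ + 1)` letters definitionally) —
the letters of ✓`B5Hk163Torus.norm_HkOp_le`, uniform in `K`, `k`, `l`, `b`.
[cite: Balaban1984PropagatorsI, (1.63) p.28, (1.65)–(1.67) p.29; Balaban1984PropagatorsII, (2.35) p.228, Prop. 2.5 p.246; Balaban1985Variational, (190) p.308 (first line)] -/
theorem norm_windowResp_univ_le (hk : k + 1 ≤ (F.P K).m + (F.P K).K) (l : RespLabel F k K) (b : PBond (F.P K) 0) :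
    |windowResp F k K Finset.univ l b| ≤
      B5Hk163Decay.MG163 (F.P K).d * B4TorusKernel.periodConst (B5Hk163Strip.kappa163 (F.P K).d) ((F.P K).d - 1) *
        Real.exp (-(B5Hk163Strip.kappa163 (F.P K).d / ((((F.P K).d - 1 : ℕ) : ℝ) + 1) *
          B4TorusKernel.MultiPeriod.torusSupNorm (Mk (F.P K) (k + 1))
            (B6LowerBound2153Torus.rep (Mk (F.P K) (k + 1)) (iterBlockOf (k + 1) b.src) - B6LowerBound2153Torus.rep (Mk (F.P K) (k + 1)) l.2))) := by
  classical
  haveI : NeZero (F.P K).L := ⟨(F.P K).L_pos.ne'⟩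
  rw [windowResp_univ_eq_re_HkOp F hk l b]
  refine (Complex.abs_re_le_norm _).trans ?_
  -- present the fine point as a block point over its `(k+1)`-block and the coarse point by its representative
  obtain ⟨y', r, hb⟩ := B5G183Kernel.exists_eq_bpt ((F.P K).L ^ (k + 1)) (Mk (F.P K) (k + 1)) (EK hk b.src)
  have hy' : iterBlockOf (k + 1) b.src = y' := by
    rw [← B6BlockDecayHjCovV1.blockOf_EK_eq_iterBlockOf hk, hb, B5Blocks16.blockOf_bpt]
  rw [hy', hb, ← B6LowerBound2153Torus.toT_rep (Mk (F.P K) (k + 1)) y', ← B6LowerBound2153Torus.toT_rep (Mk (F.P K) (k + 1)) l.2,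
    B6LowerBound2153Torus.toT_rep, B6LowerBound2153Torus.toT_rep]
  have h := norm_HkOp_le ((F.P K).L ^ (k + 1)) (Mk (F.P K) (k + 1)) b.dir l.1 r
    (B6LowerBound2153Torus.rep (Mk (F.P K) (k + 1)) y') (B6LowerBound2153Torus.rep (Mk (F.P K) (k + 1)) l.2)
  rw [B6LowerBound2153Torus.toT_rep, B6LowerBound2153Torus.toT_rep] at h
  exact h


end Summit.QuantumFields.YangMills.Theorems.PortU8

end
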